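import Summits.QuantumFields.YangMills.Theorems.LuscherReductionOneSiteLevelsKacPotentialDeriv
import Summits.QuantumFields.YangMills.Theorems.LuscherReductionOneSiteLevelsKacSpanBound

/-!
# INNER, flat lane (layer III): the cross term `|kacBil t F r| ≤ C √t ‖c‖ ‖r‖₂` (III.9)

Support module of crux `OneSiteLevels` (route `LuscherReduction`, item stmt-QuantumFields-20007), FLAT lane of the
registered v12 stub `stub_flatKacAL1` (STUB-PLAN rev 3 rows III.5/III.9).

For the eigen-span `F = Σ c_j f_j` of an AL1 family and a bounded measurable integrable `r` with `r ⊥ f_j` for all `j`: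
* `flatJumpBil_eq_sub_inner`: `flatJumpBil t u v = t⁻¹(∫ u v − ⟨P_t u, v⟩)` (jump expansion, polarised);
* `kacBil_span_eq`: `kacBil t F r = −t⁻¹ ⟨P_tF − F + t·H₀F, r⟩` (`⟨F, r⟩ = 0`, `∫ V F r = −⟨H₀F, r⟩` by the eigen-equation);
* `integral_defect_sq_le`: `‖P_tF − F + tH₀F‖₂² ≤ (t³/4) Σ_p ∫(∂_p H₀F)²` (Plancherel; multiplier `(x − (1−e^{−x}))² ≤ x³/2`);
* `abs_kacBil_span_le`: `|kacBil t F r| ≤ C √t √(Σc_j²) √(∫r²)` — the `O(√t)` cross term (trap 17: enough after AM–GM).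

Real analysis only ([folklore]); NOT the stub; femto rung R2b1; NOT a claim about the gap.
-/

set_option autoImplicit false

noncomputable section

open MeasureTheory Filter Topology Real Complex FourierTransform
open scoped RealInnerProductSpace
open Literature.Analysis.OperatorTheory.YMMatrixModel

namespace Summit.QuantumFields.YangMills.Theorems.FemtoTransferGap

/-- `(x − (1 − e^{−x}))² ≤ x³/2` for `x ≥ 0`. [folklore] -/
theorem sq_sub_one_sub_exp_neg_le {x : ℝ} (hx : 0 ≤ x) : (x - (1 - Real.exp (-x))) ^ 2 ≤ x ^ 3 / 2 := by
  have h1 : 0 ≤ x - (1 - Real.exp (-x)) := by linarith [Real.add_one_le_exp (-x)]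
  have h2 : x - (1 - Real.exp (-x)) ≤ x ^ 2 / 2 := by linarith [sub_sq_div_two_le_one_sub_exp_neg hx]
  have h3 : x - (1 - Real.exp (-x)) ≤ x := by
    have : Real.exp (-x) ≤ 1 := Real.exp_le_one_iff.mpr (by linarith)
    linarith
  nlinarith [mul_le_mul h3 h2 h1 hx]

/-! ### §1. The polarised jump expansion -/

/-- Pointwise expansion of the polarised inner jump integral for bounded measurable `u, v`:
`∫ p_t(x,y)(u x − u y)(v x − v y) dy = u x v x − u x P_t v x − v x P_t u x + P_t(uv) x`. [cite: LiebYau1988, (2.9)–(2.11)] -/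
theorem integral_heatKernel_mul_sub_mul_sub {t : ℝ} (ht : 0 < t) {u v : ZM → ℝ} (hum : Measurable u) (hvm : Measurable v)
    {Mu Mv : ℝ} (hub : ∀ y, |u y| ≤ Mu) (hvb : ∀ y, |v y| ≤ Mv) (x : ZM) :
    ∫ y, heatKernel t x y * ((u x - u y) * (v x - v y)) =
      u x * v x - u x * heatSmooth t v x - v x * heatSmooth t u x + heatSmooth t (fun y => u y * v y) x := by
  have hMu : 0 ≤ Mu := (abs_nonneg _).trans (hub x)
  have huv : ∀ y, |u y * v y| ≤ Mu * Mv := fun y => by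
    rw [abs_mul]; exact mul_le_mul (hub y) (hvb y) (abs_nonneg _) hMu
  have I0 := integrable_heatKernel_right ht x
  have Iu := integrable_heatKernel_mul ht x hum hub
  have Iv := integrable_heatKernel_mul ht x hvm hvb
  have Iuv := integrable_heatKernel_mul ht x (g := fun y => u y * v y) (hum.mul hvm) huv
  have e : ∀ y, heatKernel t x y * ((u x - u y) * (v x - v y)) =
      (u x * v x) * heatKernel t x y - u x * (heatKernel t x y * v y) - v x * (heatKernel t x y * u y)
        + heatKernel t x y * (u y * v y) := fun y => by ring
  simp_rw [e]
  have I1 : Integrable fun y => (u x * v x) * heatKernel t x y - u x * (heatKernel t x y * v y) :=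
    (I0.const_mul _).sub (Iv.const_mul _)
  have I2 : Integrable fun y => (u x * v x) * heatKernel t x y - u x * (heatKernel t x y * v y) - v x * (heatKernel t x y * u y) :=
    I1.sub (Iu.const_mul _)
  rw [integral_add I2 Iuv, integral_sub I1 (Iu.const_mul _), integral_sub (I0.const_mul _) (Iv.const_mul _),
    integral_const_mul, integral_const_mul, integral_const_mul, integral_heatKernel_right ht x]
  unfold heatSmooth
  ring

/-- **The polarised jump expansion**: `flatJumpBil t u v = t⁻¹ (∫ u v − ⟨P_t u, v⟩)` for bounded measurable integrable
`u, v`. [cite: LiebYau1988, (2.9)–(2.11)] -/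
theorem flatJumpBil_eq_sub_inner {t : ℝ} (ht : 0 < t) {u v : ZM → ℝ} (hum : Measurable u) (hvm : Measurable v)
    {Mu Mv : ℝ} (hub : ∀ y, |u y| ≤ Mu) (hvb : ∀ y, |v y| ≤ Mv) (hui : Integrable u) (hvi : Integrable v) :
    flatJumpBil t u v = (1 / t) * ((∫ x, u x * v x) - ∫ x, heatSmooth t u x * v x) := by
  have hMu : 0 ≤ Mu := (abs_nonneg _).trans (hub 0)
  have hMv : 0 ≤ Mv := (abs_nonneg _).trans (hvb 0)
  have hu2 : MemLp u 2 volume := memLp_two_of_bounded_integrable hum hub hui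
  have hv2 : MemLp v 2 volume := memLp_two_of_bounded_integrable hvm hvb hvi
  have huv : Integrable fun x => u x * v x := hu2.integrable_mul hv2
  -- integrability of the four pieces
  have hPv : Continuous (heatSmooth t v) := continuous_heatSmooth ht hvi
  have hPu : Continuous (heatSmooth t u) := continuous_heatSmooth ht hui
  have IuPv : Integrable fun x => u x * heatSmooth t v x :=
    hui.mul_bdd (c := Mv) hPv.aestronglyMeasurable (ae_of_all _ fun x => by
      rw [Real.norm_eq_abs]; exact abs_heatSmooth_le ht hvb x)
  have IvPu : Integrable fun x => v x * heatSmooth t u x :=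
    hvi.mul_bdd (c := Mu) hPu.aestronglyMeasurable (ae_of_all _ fun x => by
      rw [Real.norm_eq_abs]; exact abs_heatSmooth_le ht hub x)
  have IPuv : Integrable (heatSmooth t fun y => u y * v y) := integrable_heatSmooth ht huv
  unfold flatJumpBil
  simp_rw [integral_heatKernel_mul_sub_mul_sub ht hum hvm hub hvb]
  have I1 : Integrable fun x => u x * v x - u x * heatSmooth t v x := huv.sub IuPv
  have I2 : Integrable fun x => u x * v x - u x * heatSmooth t v x - v x * heatSmooth t u x := I1.sub IvPu
  rw [integral_add I2 IPuv, integral_sub I1 IvPu, integral_sub huv IuPv]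
  have hmass : ∫ x, heatSmooth t (fun y => u y * v y) x = ∫ x, u x * v x := by
    rw [heatSmooth_eq_heatExtension]
    exact Literature.Analysis.UnboundedOperators.integral_heatExtension_eq huv (half_pos ht)
  have htr : ∫ x, u x * heatSmooth t v x = ∫ x, heatSmooth t u x * v x := (integral_heatSmooth_mul_comm ht hu2 hv2).symm
  have htr2 : ∫ x, v x * heatSmooth t u x = ∫ x, heatSmooth t u x * v x :=
    integral_congr_ae (Eventually.of_forall fun x => by ring)
  rw [hmass, htr, htr2]
  field_simp
  ring

/-! ### §2. The cross term through the eigen-equation -/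

section Cross

variable {m : ℕ} {f : Fin (m + 1) → ZM → ℝ} (hf : IsEigenFamily m f)
include hf

/-- `hApply F = Σ c_j E_j f_j` for the span. [cite: ReedSimonIV1978, Thm. XIII.64] -/
theorem hApply_eigSpan (c : Fin (m + 1) → ℝ) (x : ZM) :
    hApply (eigSpan f c) x = ∑ j, c j * (physLevel ((j : ℕ) + 1) * f j x) := by
  rw [eigSpan_eq, hApply_sum_mul (fun j => hf.1 j 2) c x]
  exact Finset.sum_congr rfl fun j _ => by rw [hf.2.2.2.1 j x]

/-- **The cross term in closed form**: for bounded measurable integrable `r ⊥ f_j` (all `j`) and `0 < t`,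
`kacBil t F r = −t⁻¹ ∫ (P_tF − F + t·H₀F) r`. [folklore] -/
theorem kacBil_span_eq (c : Fin (m + 1) → ℝ) {t : ℝ} (ht : 0 < t) {r : ZM → ℝ} (hrm : Measurable r) {M : ℝ}
    (hrb : ∀ x, |r x| ≤ M) (hri : Integrable r) (horth : ∀ j, ∫ x, r x * f j x = 0) :
    kacBil t (eigSpan f c) r =
      -(1 / t) * ∫ x, (heatSmooth t (eigSpan f c) x - eigSpan f c x + t * eigSpanH0 f c x) * r x := by
  obtain ⟨C, hC0, hC⟩ := eigSpan_decay hf c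
  obtain ⟨hFi, -, -, -, -⟩ := eigSpan_integrable hf c
  have hFc : Continuous (eigSpan f c) := (eigSpan_contDiff hf c 0).continuous
  have hFb : ∀ x, |eigSpan f c x| ≤ C := fun x =>
    ((hC x).1).trans (by nlinarith [Real.exp_le_one_iff.mpr (neg_nonpos.mpr (norm_nonneg x)), Real.exp_pos (-‖x‖)])
  have hFK : IsKacFn (eigSpan f c) := isKacFn_span hf c
  -- `⟨F, r⟩ = 0`
  have hFr : ∫ x, eigSpan f c x * r x = 0 := by
    have Ij : ∀ j, Integrable fun x => c j * (r x * f j x) := fun j =>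
      (hri.mul_bdd (hf.1 j 0).continuous.aestronglyMeasurable (ae_of_all _ fun x => by
        rw [Real.norm_eq_abs]; exact ((hf.2.2.2.2 j).abs_le.choose_spec x))).const_mul _
    have e : ∫ x, eigSpan f c x * r x = ∫ x, ∑ j, c j * (r x * f j x) :=
      integral_congr_ae (Eventually.of_forall fun x => by
        simp only [eigSpan_apply, Finset.sum_mul]; exact Finset.sum_congr rfl fun j _ => by ring)
    rw [e, integral_finsetSum _ fun j _ => Ij j]
    simp [integral_const_mul, horth]
  -- `∫ V F r = −⟨H₀F, r⟩`
  have hH0i : Integrable (eigSpanH0 f c) := eigSpanH0_integrable hf c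
  have IHr : Integrable fun x => eigSpanH0 f c x * r x :=
    hH0i.mul_bdd (c := M) hrm.aestronglyMeasurable (ae_of_all _ fun x => by rw [Real.norm_eq_abs]; exact hrb x)
  have IEr : ∀ j, Integrable fun x => c j * (physLevel ((j : ℕ) + 1) * (r x * f j x)) := fun j =>
    ((hri.mul_bdd (hf.1 j 0).continuous.aestronglyMeasurable (ae_of_all _ fun x => by
      rw [Real.norm_eq_abs]; exact ((hf.2.2.2.2 j).abs_le.choose_spec x))).const_mul _).const_mul _
  have hVFr : ∫ x, luscherPotential x * (eigSpan f c x * r x) = -∫ x, eigSpanH0 f c x * r x := by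
    -- `V F = hApply F − H₀F` pointwise
    have e : ∀ x, luscherPotential x * (eigSpan f c x * r x) =
        (∑ j, c j * (physLevel ((j : ℕ) + 1) * (r x * f j x))) - eigSpanH0 f c x * r x := fun x => by
      have h := hApply_eigSpan hf c x
      rw [hApply_def] at h
      rw [eigSpanH0_apply]
      have : (∑ j, c j * (physLevel ((j : ℕ) + 1) * (r x * f j x))) = (∑ j, c j * (physLevel ((j : ℕ) + 1) * f j x)) * r x := by
        rw [Finset.sum_mul]; exact Finset.sum_congr rfl fun j _ => by ring
      rw [this, ← h]; ring
    simp_rw [e]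
    rw [integral_sub (integrable_finsetSum _ fun j _ => IEr j) IHr, integral_finsetSum _ fun j _ => IEr j]
    simp [integral_const_mul, horth]
  -- assemble
  unfold kacBil
  rw [flatJumpBil_eq_sub_inner ht hFc.measurable hrm hFb hrb hFi hri, hFr, hVFr]
  have IPr : Integrable fun x => heatSmooth t (eigSpan f c) x * r x :=
    (hri.bdd_mul (c := C) (continuous_heatSmooth ht hFi).aestronglyMeasurable (ae_of_all _ fun x => by
      rw [Real.norm_eq_abs]; exact abs_heatSmooth_le ht hFb x))
  have IFr : Integrable fun x => eigSpan f c x * r x := hFK.integrable.mul_bdd (c := M) hrm.aestronglyMeasurable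
    (ae_of_all _ fun x => by rw [Real.norm_eq_abs]; exact hrb x)
  have I12 : Integrable fun x => heatSmooth t (eigSpan f c) x * r x - eigSpan f c x * r x := IPr.sub IFr
  have I3 : Integrable fun x => t * (eigSpanH0 f c x * r x) := IHr.const_mul _
  have e2 : ∫ x, (heatSmooth t (eigSpan f c) x - eigSpan f c x + t * eigSpanH0 f c x) * r x =
      (∫ x, heatSmooth t (eigSpan f c) x * r x) - (∫ x, eigSpan f c x * r x) + t * ∫ x, eigSpanH0 f c x * r x := by
    rw [← integral_sub IPr IFr, ← integral_const_mul, ← integral_add I12 I3]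
    exact integral_congr_ae (Eventually.of_forall fun x => by ring)
  rw [e2, hFr]
  field_simp
  ring

/-- **The defect in `L²`**: `∫ (P_tF − F + tH₀F)² ≤ (t³/4) Σ_p ∫ (∂_p H₀F)²` (Plancherel, multiplier
`(e^{−ta} − 1 + ta)² ≤ (ta)³/2`, and `∫ a³‖𝓕F‖² = ∫ a‖𝓕(H₀F)‖² = ½Σ_p∫(∂_pH₀F)²`). [folklore] -/
theorem integral_defect_sq_le (c : Fin (m + 1) → ℝ) {t : ℝ} (ht : 0 < t) :
    Integrable (fun x => (heatSmooth t (eigSpan f c) x - eigSpan f c x + t * eigSpanH0 f c x) ^ 2) ∧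
      ∫ x, (heatSmooth t (eigSpan f c) x - eigSpan f c x + t * eigSpanH0 f c x) ^ 2 ≤
        t ^ 3 / 4 * ∑ p, ∫ x, pderiv p (eigSpanH0 f c) x ^ 2 := by
  obtain ⟨C, hC0, hC⟩ := eigSpan_decay hf c
  obtain ⟨hFi, -, -, hF2, -⟩ := eigSpan_integrable hf c
  have hFc : Continuous (eigSpan f c) := (eigSpan_contDiff hf c 0).continuous
  have hFb : ∀ x, |eigSpan f c x| ≤ C := fun x =>
    ((hC x).1).trans (by nlinarith [Real.exp_le_one_iff.mpr (neg_nonpos.mpr (norm_nonneg x)), Real.exp_pos (-‖x‖)])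
  have hF2m : MemLp (eigSpan f c) 2 volume := memLp_two_of_bounded_integrable hFc.measurable hFb hFi
  have hPi : Integrable (heatSmooth t (eigSpan f c)) := integrable_heatSmooth ht hFi
  have hP2m : MemLp (heatSmooth t (eigSpan f c)) 2 volume := memLp_two_heatSmooth ht hF2m
  have hHi : Integrable (eigSpanH0 f c) := eigSpanH0_integrable hf c
  have hH2 : Integrable fun x => eigSpanH0 f c x ^ 2 := (integral_eigSpanH0_sq_le hf c).1
  have hHc : Continuous (eigSpanH0 f c) := eigSpanH0_continuous hf c
  have hH2m : MemLp (eigSpanH0 f c) 2 volume := (memLp_two_iff_integrable_sq hHc.aestronglyMeasurable).2 hH2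
  -- the defect `D`
  set D : ZM → ℝ := fun x => heatSmooth t (eigSpan f c) x - eigSpan f c x + t * eigSpanH0 f c x with hD
  have hDi : Integrable D := (hPi.sub hFi).add (hHi.const_mul t)
  have hDm : MemLp D 2 volume := (hP2m.sub hF2m).add (hH2m.const_mul t)
  have hD2 : Integrable fun x => D x ^ 2 := hDm.integrable_sq
  refine ⟨hD2, ?_⟩
  -- Fourier side
  obtain ⟨hhP, hhP2, hhD⟩ := eigSpanH0_deriv_integrable hf c
  have hh1 : ContDiff ℝ 1 (eigSpanH0 f c) := eigSpanH0_contDiff hf c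
  obtain ⟨hAint, hAeq⟩ := half_sum_integral_pderiv_sq_eq_fourier hh1 hHi hhD hhP hhP2
  rw [l2_eq_fourier hDi hD2]
  -- `𝓕(cpx D) = (e^{−ta} − 1 + ta) 𝓕F`
  have hFT : ∀ ξ : ZM, 𝓕 (cpx D) ξ =
      ((Real.exp (-(t * (2 * π ^ 2 * ‖ξ‖ ^ 2))) - 1 + t * (2 * π ^ 2 * ‖ξ‖ ^ 2) : ℝ) : ℂ) * 𝓕 (cpx (eigSpan f c)) ξ := by
    intro ξ
    have e : cpx D = (cpx (heatSmooth t (eigSpan f c)) - cpx (eigSpan f c)) + fun x => (t : ℂ) * cpx (eigSpanH0 f c) x := by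
      funext x; simp only [hD, cpx_apply, Pi.add_apply, Pi.sub_apply]; push_cast; ring
    rw [e, fourier_add_apply ((integrable_cpx hPi).sub (integrable_cpx hFi)) ((integrable_cpx hHi).const_mul _),
      fourier_sub_apply (integrable_cpx hPi) (integrable_cpx hFi), fourier_const_mul_apply,
      fourier_cpx_heatSmooth ht hFi, fourier_cpx_eigSpanH0 hf c ξ]
    unfold Literature.Analysis.UnboundedOperators.heatSymbol
    have : -(2 * π) ^ 2 * (t / 2) * ‖ξ‖ ^ 2 = -(t * (2 * π ^ 2 * ‖ξ‖ ^ 2)) := by ring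
    rw [this]
    push_cast
    ring
  have hpt : ∀ ξ : ZM, ‖𝓕 (cpx D) ξ‖ ^ 2 ≤ t ^ 3 / 2 * (2 * π ^ 2 * ‖ξ‖ ^ 2 * ‖𝓕 (cpx (eigSpanH0 f c)) ξ‖ ^ 2) := by
    intro ξ
    set a : ℝ := 2 * π ^ 2 * ‖ξ‖ ^ 2 with ha
    have ha0 : 0 ≤ a := by positivity
    rw [hFT ξ, norm_mul, mul_pow, Complex.norm_real, Real.norm_eq_abs, sq_abs, fourier_cpx_eigSpanH0 hf c ξ, norm_mul,
      Complex.norm_real, Real.norm_eq_abs, abs_of_nonneg ha0, mul_pow]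
    have hm : (Real.exp (-(t * a)) - 1 + t * a) ^ 2 ≤ (t * a) ^ 3 / 2 := by
      have := sq_sub_one_sub_exp_neg_le (mul_nonneg ht.le ha0)
      have e : t * a - (1 - Real.exp (-(t * a))) = Real.exp (-(t * a)) - 1 + t * a := by ring
      rwa [e] at this
    have hn := sq_nonneg ‖𝓕 (cpx (eigSpan f c)) ξ‖
    calc (Real.exp (-(t * a)) - 1 + t * a) ^ 2 * ‖𝓕 (cpx (eigSpan f c)) ξ‖ ^ 2
        ≤ (t * a) ^ 3 / 2 * ‖𝓕 (cpx (eigSpan f c)) ξ‖ ^ 2 := mul_le_mul_of_nonneg_right hm hn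
      _ = t ^ 3 / 2 * (a * (a ^ 2 * ‖𝓕 (cpx (eigSpan f c)) ξ‖ ^ 2)) := by ring
  have hdom : Integrable fun ξ : ZM => t ^ 3 / 2 * (2 * π ^ 2 * ‖ξ‖ ^ 2 * ‖𝓕 (cpx (eigSpanH0 f c)) ξ‖ ^ 2) :=
    hAint.const_mul _
  calc ∫ ξ, ‖𝓕 (cpx D) ξ‖ ^ 2 ≤ ∫ ξ : ZM, t ^ 3 / 2 * (2 * π ^ 2 * ‖ξ‖ ^ 2 * ‖𝓕 (cpx (eigSpanH0 f c)) ξ‖ ^ 2) :=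
        integral_mono (integrable_norm_sq_fourier_cpx hDi hD2) hdom hpt
    _ = t ^ 3 / 2 * ((1 / 2 : ℝ) * ∑ p, ∫ x, pderiv p (eigSpanH0 f c) x ^ 2) := by rw [integral_const_mul, ← hAeq]
    _ = t ^ 3 / 4 * ∑ p, ∫ x, pderiv p (eigSpanH0 f c) x ^ 2 := by ring

/-- **III.9 — the cross term is `O(√t)`**: there is `C ≥ 0` (depending on the family only) such that for `0 < t`,
every coefficient vector and every bounded measurable integrable `r ⊥ f_j`:
`|kacBil t (Σ c_j f_j) r| ≤ C √t √(Σ c_j²) √(∫ r²)`. [folklore] -/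
theorem abs_kacBil_span_le : ∃ C : ℝ, 0 ≤ C ∧ ∀ t : ℝ, 0 < t → ∀ (c : Fin (m + 1) → ℝ) (r : ZM → ℝ),
    Measurable r → ∀ M : ℝ, (∀ x, |r x| ≤ M) → Integrable r → (∀ j, ∫ x, r x * f j x = 0) →
      |kacBil t (fun x => ∑ j, c j * f j x) r| ≤ C * Real.sqrt t * Real.sqrt (∑ j, c j ^ 2) * Real.sqrt (∫ x, r x ^ 2) := by
  obtain ⟨K', hK'0, hK'⟩ := sum_integral_pderiv_eigSpanH0_sq_le hf
  refine ⟨Real.sqrt (K' / 4), Real.sqrt_nonneg _, fun t ht c r hrm M hrb hri horth => ?_⟩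
  have hr2m : MemLp r 2 volume := memLp_two_of_bounded_integrable hrm hrb hri
  obtain ⟨hD2, hDle⟩ := integral_defect_sq_le hf c ht
  set D : ZM → ℝ := fun x => heatSmooth t (eigSpan f c) x - eigSpan f c x + t * eigSpanH0 f c x with hD
  have hDm : MemLp D 2 volume := by
    refine (memLp_two_iff_integrable_sq ?_).2 hD2
    obtain ⟨hFi, -⟩ := eigSpan_integrable hf c
    exact (((continuous_heatSmooth ht hFi).sub (eigSpan_contDiff hf c 0).continuous).add
      (continuous_const.mul (eigSpanH0_continuous hf c))).aestronglyMeasurable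
  rw [show (fun x => ∑ j, c j * f j x) = eigSpan f c from rfl, kacBil_span_eq hf c ht hrm hrb hri horth]
  have hcs := abs_integral_mul_le_sqrt_mul_sqrt hDm hr2m
  -- `√(∫D²) ≤ t √(t K'/4 Σc²)`
  have hS : 0 ≤ ∑ j, c j ^ 2 := Finset.sum_nonneg fun j _ => sq_nonneg _
  have hDbound : ∫ x, D x ^ 2 ≤ t ^ 2 * (t * (K' / 4) * ∑ j, c j ^ 2) := by
    calc ∫ x, D x ^ 2 ≤ t ^ 3 / 4 * ∑ p, ∫ x, pderiv p (eigSpanH0 f c) x ^ 2 := hDle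
      _ ≤ t ^ 3 / 4 * (K' * ∑ j, c j ^ 2) := mul_le_mul_of_nonneg_left (hK' c) (by positivity)
      _ = t ^ 2 * (t * (K' / 4) * ∑ j, c j ^ 2) := by ring
  have hsqrtD : Real.sqrt (∫ x, D x ^ 2) ≤ t * (Real.sqrt (K' / 4) * Real.sqrt t * Real.sqrt (∑ j, c j ^ 2)) := by
    calc Real.sqrt (∫ x, D x ^ 2) ≤ Real.sqrt (t ^ 2 * (t * (K' / 4) * ∑ j, c j ^ 2)) := Real.sqrt_le_sqrt hDbound
      _ = t * Real.sqrt (t * (K' / 4) * ∑ j, c j ^ 2) := by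
          rw [Real.sqrt_mul (sq_nonneg t), Real.sqrt_sq ht.le]
      _ = t * (Real.sqrt (K' / 4) * Real.sqrt t * Real.sqrt (∑ j, c j ^ 2)) := by
          rw [Real.sqrt_mul (by positivity), Real.sqrt_mul ht.le]; ring
  rw [abs_mul, abs_neg, abs_of_pos (by positivity : (0:ℝ) < 1 / t)]
  have hr0 := Real.sqrt_nonneg (∫ x, r x ^ 2)
  calc 1 / t * |∫ x, D x * r x| ≤ 1 / t * (Real.sqrt (∫ x, D x ^ 2) * Real.sqrt (∫ x, r x ^ 2)) :=
        mul_le_mul_of_nonneg_left hcs (by positivity)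
    _ ≤ 1 / t * (t * (Real.sqrt (K' / 4) * Real.sqrt t * Real.sqrt (∑ j, c j ^ 2)) * Real.sqrt (∫ x, r x ^ 2)) :=
        mul_le_mul_of_nonneg_left (mul_le_mul_of_nonneg_right hsqrtD hr0) (by positivity)
    _ = Real.sqrt (K' / 4) * Real.sqrt t * Real.sqrt (∑ j, c j ^ 2) * Real.sqrt (∫ x, r x ^ 2) := by
        field_simp

end Cross

end Summit.QuantumFields.YangMills.Theorems.FemtoTransferGap

end
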